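import Summits.ValiantsHypothesis.ValiantsHypothesis.Theorems.DivisionGapPerDivisionHardStubJssContraction
import Summits.ValiantsHypothesis.ValiantsHypothesis.Theorems.DivisionGapPerDivisionHardStubFaceDescent
import Summits.ValiantsHypothesis.ValiantsHypothesis.Theorems.DivisionGapPerDivisionHardStubBlockArsenal
import Summits.ValiantsHypothesis.ValiantsHypothesis.Theorems.DivisionGapPerDivisionHardStubGenericCut
import Summits.ValiantsHypothesis.ValiantsHypothesis.Theorems.DivisionGapPerDivisionHardStubQPotential
import Summits.ValiantsHypothesis.ValiantsHypothesis.Theorems.DivisionGapPerDivisionHardStubBlockFits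

/-!
# Crux `DivisionGap.PerDivisionHard` (stmt-ValiantsHypothesis-5065), line `pair-descent-jss-endpoint` —
RUNG 5: the crux for cofactors supported on ODD-FREE permutation families (arithmetic rigidity)

`PerDivisionHard` asks: for every `c`, for all large `n`, every nonzero `h ∈ ℝ≥0[x_ij]` has
`2^{(log₂ n + c)^c} < L(per_n · h) + L(h)`.  This file proves it UNCONDITIONALLY for every cofactor
`h` supported (with arbitrary nonnegative coefficients) on the permutation monomials of a family
`S ⊆ S_n` whose difference set `S⁻¹S` contains no element of order divisible by `2k+1`, for any
`1 ≤ k ≤ √n` (`perDivisionHard_oddFree`), and hence for every cofactor supported on a subgroup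
`Γ ≤ S_n` whose order is prime to `2k+1` (`perDivisionHard_coprimeGroup`): all `2`-groups (the
disprover's `Aut(T_n)` group permanents, `2^{n-1}` monomials at cost `O(n²)`), all `p`-groups,
iterated wreath towers of small symmetric groups, … — rigid at EVERY placement, no counting.

Mechanism (composition of landed stubs of the line, skeleton v4–v6
`Cruxes/PerDivisionHard/Lines/pair_descent_jss_endpoint.lean`):
* `stub_blockFits` (p107894): the block `G(b,k) ⊕ M₀`, `b = (log₂ n + d)^d`, fits for `k² ≤ n`;
* `stub_genericCut` (p107596): the generic weight cuts out the placed face `G` and its top fibre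
  agrees off `G`;
* `stub_qPotential` (p107307): two permutation monomials agreeing off a placed `G(b,k) ⊕ M₀` are
  equal or differ by `τ = σ⁻¹σ'` with `(2k+1) ∣ orderOf τ` — so on an odd-free family the top fibre
  is a SINGLE monomial;
* `stub_faceDescent` (p87774), `stub_jssContraction` (p86475), `stub_blockArsenal` (p87932): the
  lever, the Jukna–Seiwert–Sergeev endpoint and the hardness of the placed face.
-/

noncomputable section

-- `Summit.ValiantsHypothesis.ValiantsHypothesis.…` is the tree's mandated single-conjunct layout
-- (Sub = Summit), so the duplicated namespace component is intended.
set_option linter.dupNamespace false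

namespace Summit.ValiantsHypothesis.ValiantsHypothesis.Theorems.DivisionGapPerDivisionHard

open MvPolynomial Literature.Computability.AlgebraicComplexity
open Summit.ValiantsHypothesis.ValiantsHypothesis.Theorems.ZeroOneTransfer.Negative
  (topComponent support_topComponent_subset topComponent_ne_zero)
open scoped NNReal

/-- Permutation monomials have degree `n`. [folklore] -/
theorem degree_permMonomial_eq (n : ℕ) (σ : Equiv.Perm (Fin n)) : (permMonomial σ).degree = n := by
  simp [permMonomial, map_sum]

/-- **Rung 5 of the crux (odd-free permutation supports): `PerDivisionHard` for every cofactor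
supported on a permutation family whose difference set has no element of order divisible by
`2k+1`, `1 ≤ k`, `k² ≤ n`** — at EVERY placement the top fibre of the generic cut is a single
monomial (arithmetic rigidity, `stub_qPotential`), then face descent, JSS contraction and the
hardness of the placed block face. -/
theorem perDivisionHard_oddFree :
    ∀ c : ℕ, ∃ n₀ : ℕ, ∀ n ≥ n₀, ∀ (k : ℕ) (S : Finset (Equiv.Perm (Fin n))), 0 < k → k * k ≤ n →
      (∀ σ ∈ S, ∀ σ' ∈ S, σ ≠ σ' → ¬ (2 * k + 1) ∣ orderOf (σ⁻¹ * σ')) →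
      ∀ h : MvPolynomial (Fin n × Fin n) ℝ≥0, h ≠ 0 →
      (∀ m ∈ h.support, ∃ σ ∈ S, permMonomial σ = m) →
      2 ^ ((Nat.log 2 n + c) ^ c) < complexity (perPoly (Fin n) ℝ≥0 * h) + complexity h := by
  intro c
  obtain ⟨κ, hcon⟩ := stub_jssContraction
  obtain ⟨d, n₁, hhard⟩ := stub_blockArsenal c κ
  obtain ⟨n₂, hfit⟩ := stub_blockFits d
  refine ⟨n₁ + n₂, ?_⟩
  intro n hn k S hk hkk hS h hh hsupp
  have hfit' := hfit n (by omega) k hkk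
  set b := (Nat.log 2 n + d) ^ d with hb
  set m := n - (b + b * (b * k)) with hm
  -- a placement: any labelling of the rows and columns
  have hcard : Fintype.card (BlockV b k m) = Fintype.card (Fin n) := by
    simp only [BlockV, Fintype.card_sum, Fintype.card_prod, Fintype.card_fin]
    omega
  obtain ⟨eR⟩ : Nonempty (BlockV b k m ≃ Fin n) := ⟨Fintype.equivOfCardEq hcard⟩
  set G := placedBlock eR eR with hG
  -- the generic cut: all monomials of `h` are permutation monomials, of degree `n`
  have hdeg : ∀ m₁ ∈ h.support, ∀ m₂ ∈ h.support, m₁.degree = m₂.degree := by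
    intro m₁ hm₁ m₂ hm₂
    obtain ⟨σ₁, -, rfl⟩ := hsupp m₁ hm₁
    obtain ⟨σ₂, -, rfl⟩ := hsupp m₂ hm₂
    rw [degree_permMonomial_eq, degree_permMonomial_eq]
  obtain ⟨w, hcut, hagree⟩ := stub_genericCut b k m n eR eR h hk hdeg
  -- arithmetic rigidity: the top fibre is a single monomial
  have hfib : ∀ m₁ ∈ (topComponent w h).support, ∀ m₂ ∈ (topComponent w h).support, m₁ = m₂ := by
    intro m₁ hm₁ m₂ hm₂
    obtain ⟨σ₁, hσ₁, rfl⟩ := hsupp m₁ (support_topComponent_subset _ h hm₁)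
    obtain ⟨σ₂, hσ₂, rfl⟩ := hsupp m₂ (support_topComponent_subset _ h hm₂)
    by_cases hne : σ₁ = σ₂
    · rw [hne]
    · rcases stub_qPotential b k m n eR eR σ₁ σ₂ hk (hagree _ hm₁ _ hm₂) with h12 | hdvd
      · exact absurd h12 hne
      · exact absurd hdvd (hS σ₁ hσ₁ σ₂ hσ₂ hne)
  obtain ⟨m₀, hm₀⟩ := support_nonempty.mpr (topComponent_ne_zero w hh)
  have hsingle : HasSingleGPart G w h (m₀.filter (· ∈ G)) := by
    refine ⟨fun e he => ?_, fun m' hm' e he => ?_⟩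
    · rw [Finsupp.support_filter] at he
      exact (Finset.mem_filter.mp he).2
    · rw [hfib m' hm' m₀ hm₀, Finsupp.filter_apply_pos _ _ he]
  by_contra hlt
  have hle : complexity (perPoly (Fin n) ℝ≥0 * h) + complexity h ≤
      2 ^ ((Nat.log 2 n + c) ^ c) := not_lt.mp hlt
  -- face descent, JSS contraction, hardness of the placed face
  have hdesc := stub_faceDescent n G w h (m₀.filter (· ∈ G)) hcut hh hsingle
  have h1 : complexity (monomial (m₀.filter (· ∈ G)) (1 : ℝ≥0) * facePer G) ≤
      2 ^ ((Nat.log 2 n + c) ^ c) + 1 :=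
    calc complexity (monomial (m₀.filter (· ∈ G)) (1 : ℝ≥0) * facePer G)
        ≤ complexity (perPoly (Fin n) ℝ≥0 * h) + 1 := hdesc
      _ ≤ 2 ^ ((Nat.log 2 n + c) ^ c) + 1 :=
          Nat.add_le_add_right (le_trans (Nat.le_add_right _ _) hle) 1
  have h2 : complexity (facePer G) ≤ ((n + 2) * (2 ^ ((Nat.log 2 n + c) ^ c) + 3)) ^ κ :=
    calc complexity (facePer G)
        ≤ ((n + 2) * (complexity (monomial (m₀.filter (· ∈ G)) (1 : ℝ≥0) * facePer G) + 2)) ^ κ :=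
          hcon n (facePer G) (m₀.filter (· ∈ G))
      _ ≤ ((n + 2) * (2 ^ ((Nat.log 2 n + c) ^ c) + 3)) ^ κ :=
          Nat.pow_le_pow_left (Nat.mul_le_mul_left _ (by omega)) κ
  have h3 := hhard n (by omega) b k m eR eR (le_of_eq hb.symm)
  exact absurd (lt_of_lt_of_le h3 h2) (lt_irrefl _)

/-- **Corollary (group form).**  `PerDivisionHard` for every cofactor supported on (the permutation
monomials of) a subgroup `Γ ≤ S_n` whose order is prime to `2k+1` for some `1 ≤ k`, `k² ≤ n` — e.g.
every `2`-group (`k = 1`), every `p`-group (`p ≠ 2k+1`), every group generated by elements of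
orders `< 2k+1` with `2k+1` prime … : `orderOf (σ⁻¹σ') ∣ |Γ|`. -/
theorem perDivisionHard_coprimeGroup :
    ∀ c : ℕ, ∃ n₀ : ℕ, ∀ n ≥ n₀, ∀ (k : ℕ) (Γ : Subgroup (Equiv.Perm (Fin n))), 0 < k →
      k * k ≤ n → ¬ (2 * k + 1) ∣ Nat.card Γ →
      ∀ h : MvPolynomial (Fin n × Fin n) ℝ≥0, h ≠ 0 →
      (∀ m ∈ h.support, ∃ σ ∈ Γ, permMonomial σ = m) →
      2 ^ ((Nat.log 2 n + c) ^ c) < complexity (perPoly (Fin n) ℝ≥0 * h) + complexity h := by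
  classical
  intro c
  obtain ⟨n₀, H⟩ := perDivisionHard_oddFree c
  refine ⟨n₀, fun n hn k Γ hk hkk hΓ h hh hsupp => ?_⟩
  set S : Finset (Equiv.Perm (Fin n)) := Finset.univ.filter (· ∈ Γ) with hSdef
  refine H n hn k S hk hkk ?_ h hh ?_
  · intro σ hσ σ' hσ' _ hdvd
    have hσΓ : σ ∈ Γ := (Finset.mem_filter.mp hσ).2
    have hσ'Γ : σ' ∈ Γ := (Finset.mem_filter.mp hσ').2
    have hmem : σ⁻¹ * σ' ∈ Γ := Γ.mul_mem (Γ.inv_mem hσΓ) hσ'Γ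
    exact hΓ (hdvd.trans (Subgroup.orderOf_dvd_natCard Γ hmem))
  · intro m' hm'
    obtain ⟨σ, hσ, rfl⟩ := hsupp m' hm'
    exact ⟨σ, Finset.mem_filter.mpr ⟨Finset.mem_univ _, hσ⟩, rfl⟩

end Summit.ValiantsHypothesis.ValiantsHypothesis.Theorems.DivisionGapPerDivisionHard

end
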